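import Literature.Geometry.Riemannian.PinchingEstimatesTwoSingularCore
import Literature.Geometry.Riemannian.PinchingEstimatesTwoLargest
import HarnessLib

/-!
# Hamilton 1997, Thm. 1.3 at the level of the curvature ODE — proved
(topic `Geometry/Riemannian`)

Part of the decomposition of `Literature.Geometry.Riemannian.hamilton_chenZhu_pinching`
(`PinchingEstimates.lean`). Hamilton 1997, §2.1, Thm. 1.3 (p. 7): "There exist a constant
`Λ < ∞` depending only on the initial metric such that `(b₂ + b₃)² ≤ Λ(a₁ + a₂)(c₁ + c₂)`"
[is preserved]. PROVED here at the ODE level, in the shape of the Thm. 1.3 hypothesis of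
`hamilton_chenZhu_pinching_of_ode₅` (`PinchingEstimatesReduction3.lean`):

* `hamilton1997_B13_ode` — for `0 < m`, `0 < Λ`, `{(b₂ + b₃)² ≤ Λ(a₁ + a₂)(c₁ + c₂)}`
  (`SingularValuesSumSqLE`) is forward invariant under Hamilton's ODE relative to
  `{A, C symmetric} ∩ {a₁ + a₂ ≥ m} ∩ {c₁ + c₂ ≥ m}`.

Proof: barrier lemma `minOverSet_nonneg_of_deriv` (`HamiltonODEMinBarrier.lean`) for
`G = Λ X(w, w') X_C(z, z') - Y²` over `pairSet⁴`; at a minimiser with `G ≤ 0` the frames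
maximise `Y` up to sign, are rotated to a diagonal maximiser (`exists_halfAngle`,
`kyFan_rotate`), and the pointwise bounds of `PinchingEstimatesTwoSingularCore.lean` give
`G' ≥ S · G`.

## References

* R. S. Hamilton, Comm. Anal. Geom. 5 (1997), §2.1, Thm. 1.3 and its proof (pp. 7–8). [Hamilton1997]
* R. S. Hamilton, J. Differential Geom. 24 (1986), §3 (Lemmas 3.1, 3.5), §6 (Lemma 6.1). [Hamilton1986]
-/

noncomputable section

open Set Real Filter
open scoped Matrix BigOperators Topology

namespace Literature.Geometry.Riemannian

namespace HamiltonODE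

/-- The Ky Fan bilinear sum `u₁ᵀBv₁ + u₂ᵀBv₂` of a pair of 2-frames `(U, V)`. [folklore] -/
abbrev kyFanQ (B : Matrix (Fin 3) (Fin 3) ℝ) (F : PP) : ℝ :=
  F.1.1 ⬝ᵥ (B *ᵥ F.2.1) + F.1.2 ⬝ᵥ (B *ᵥ F.2.2)

/-- The parameter set `pairSet⁴`, `q = ((U, V), (W, Z))`. [folklore] -/
def pairSet4 : Set (PP × PP) := (pairSet ×ˢ pairSet) ×ˢ (pairSet ×ˢ pairSet)

/-- It is compact. [folklore] -/
theorem isCompact_pairSet4 : IsCompact pairSet4 :=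
  (isCompact_pairSet.prod isCompact_pairSet).prod (isCompact_pairSet.prod isCompact_pairSet)

/-- It is nonempty. [folklore] -/
theorem pairSet4_nonempty : pairSet4.Nonempty :=
  (pairSet_nonempty.prod pairSet_nonempty).prod (pairSet_nonempty.prod pairSet_nonempty)

/-- Hamilton's Thm. 1.3 functional `G = Λ X(W) X_C(Z) - Y(U, V)²`. [folklore] -/
def twoSingularG (Λ : ℝ) (p : Blocks) (q : PP × PP) : ℝ :=
  Λ * pairSumQ p.1 q.2.1 * pairSumQ p.2.2 q.2.2 - kyFanQ p.2.1 q.1 ^ 2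

/-- Its derivative along a curve with velocity `p'`. [folklore] -/
def twoSingularG' (Λ : ℝ) (p p' : Blocks) (q : PP × PP) : ℝ :=
  Λ * (pairSumQ p'.1 q.2.1 * pairSumQ p.2.2 q.2.2 + pairSumQ p.1 q.2.1 * pairSumQ p'.2.2 q.2.2) -
    2 * kyFanQ p.2.1 q.1 * kyFanQ p'.2.1 q.1

/-- `(b₂ + b₃)² ≤ Λ(a₁ + a₂)(c₁ + c₂)` iff `G ≥ 0` on `pairSet⁴`. [folklore] -/
theorem singularValuesSumSqLE_iff (Λ : ℝ) (p : Blocks) :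
    SingularValuesSumSqLE p Λ ↔ ∀ q ∈ pairSet4, 0 ≤ twoSingularG Λ p q := by
  constructor
  · rintro h ⟨⟨⟨u₁, u₂⟩, ⟨v₁, v₂⟩⟩, ⟨⟨w, w'⟩, ⟨z, z'⟩⟩⟩ ⟨⟨⟨hu₁, hu₂, hu⟩, ⟨hv₁, hv₂, hv⟩⟩,
      ⟨⟨hw, hw', hww'⟩, ⟨hz, hz', hzz'⟩⟩⟩
    have := h u₁ u₂ v₁ v₂ w w' z z' hu₁ hu₂ hu hv₁ hv₂ hv hw hw' hww' hz hz' hzz'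
    simp only [twoSingularG, kyFanQ, pairSumQ]; linarith
  · intro h u₁ u₂ v₁ v₂ w w' z z' hu₁ hu₂ hu hv₁ hv₂ hv hw hw' hww' hz hz' hzz'
    have := h (((u₁, u₂), (v₁, v₂)), ((w, w'), (z, z'))) ⟨⟨⟨hu₁, hu₂, hu⟩, ⟨hv₁, hv₂, hv⟩⟩,
      ⟨⟨hw, hw', hww'⟩, ⟨hz, hz', hzz'⟩⟩⟩
    simp only [twoSingularG, kyFanQ, pairSumQ] at this; linarith

/-! ### Calculus -/

/-- Derivative of a pair sum along a matrix curve. [folklore] -/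
theorem hasDerivAt_pairSumQ {A : ℝ → Matrix (Fin 3) (Fin 3) ℝ} {A' : Matrix (Fin 3) (Fin 3) ℝ} {s : ℝ}
    (hA : ∀ k l, _root_.HasDerivAt (fun t ↦ A t k l) (A' k l) s) (W : (Fin 3 → ℝ) × (Fin 3 → ℝ)) :
    _root_.HasDerivAt (fun t ↦ pairSumQ (A t) W) (pairSumQ A' W) s :=
  (hasDerivAt_quadForm hA _ _).add (hasDerivAt_quadForm hA _ _)

/-- Derivative of a Ky Fan sum along a matrix curve. [folklore] -/
theorem hasDerivAt_kyFanQ {B : ℝ → Matrix (Fin 3) (Fin 3) ℝ} {B' : Matrix (Fin 3) (Fin 3) ℝ} {s : ℝ}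
    (hB : ∀ k l, _root_.HasDerivAt (fun t ↦ B t k l) (B' k l) s) (F : PP) :
    _root_.HasDerivAt (fun t ↦ kyFanQ (B t) F) (kyFanQ B' F) s :=
  (hasDerivAt_quadForm hB _ _).add (hasDerivAt_quadForm hB _ _)

/-- Derivative of `G` along a differentiable curve of blocks. [folklore] -/
theorem hasDerivAt_twoSingularG (Λ : ℝ) {γ : ℝ → Blocks} {γ' : Blocks} {s : ℝ}
    (hγ : HasDerivAt γ γ' s) (q : PP × PP) :
    _root_.HasDerivAt (fun t ↦ twoSingularG Λ (γ t) q) (twoSingularG' Λ (γ s) γ' q) s := by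
  have hX := hasDerivAt_pairSumQ hγ.1 q.2.1
  have hZ := hasDerivAt_pairSumQ hγ.2.2 q.2.2
  have hY := hasDerivAt_kyFanQ hγ.2.1 q.1
  have h := ((hX.mul hZ).const_mul Λ).sub (hY.pow 2)
  have e : (fun t ↦ twoSingularG Λ (γ t) q) =
      (fun y ↦ Λ * ((fun t ↦ pairSumQ (γ t).1 q.2.1) * fun t ↦ pairSumQ (γ t).2.2 q.2.2) y) -
        (fun t ↦ kyFanQ (γ t).2.1 q.1) ^ 2 := by
    funext t; simp only [twoSingularG, Pi.sub_apply, Pi.mul_apply, Pi.pow_apply]; ring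
  rw [e]
  refine h.congr_deriv ?_
  simp only [twoSingularG', Nat.cast_ofNat]
  ring

/-- `(M, W) ↦ X` is continuous. [folklore] -/
theorem continuous_pairSumQ' :
    Continuous fun z : Matrix (Fin 3) (Fin 3) ℝ × ((Fin 3 → ℝ) × (Fin 3 → ℝ)) ↦ pairSumQ z.1 z.2 := by
  have h := continuous_quadForm
  exact (h.comp (continuous_fst.prodMk ((continuous_fst.comp continuous_snd).prodMk
    (continuous_fst.comp continuous_snd)))).add
    (h.comp (continuous_fst.prodMk ((continuous_snd.comp continuous_snd).prodMk
    (continuous_snd.comp continuous_snd))))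

/-- `(M, F) ↦ Y` is continuous. [folklore] -/
theorem continuous_kyFanQ' : Continuous fun z : Matrix (Fin 3) (Fin 3) ℝ × PP ↦ kyFanQ z.1 z.2 := by
  have h := continuous_quadForm
  exact (h.comp (continuous_fst.prodMk ((continuous_fst.comp (continuous_fst.comp continuous_snd)).prodMk
    (continuous_fst.comp (continuous_snd.comp continuous_snd))))).add
    (h.comp (continuous_fst.prodMk ((continuous_snd.comp (continuous_fst.comp continuous_snd)).prodMk
    (continuous_snd.comp (continuous_snd.comp continuous_snd)))))

/-- `(p, p', q) ↦ G'` is continuous (and `G` is the special case read off below). [folklore] -/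
theorem continuous_twoSingularG' (Λ : ℝ) :
    Continuous fun z : Blocks × Blocks × (PP × PP) ↦ twoSingularG' Λ z.1 z.2.1 z.2.2 := by
  unfold twoSingularG'
  have hX := continuous_pairSumQ'
  have hY := continuous_kyFanQ'
  have hp : Continuous fun z : Blocks × Blocks × (PP × PP) ↦ z.1 := continuous_fst
  have hp' : Continuous fun z : Blocks × Blocks × (PP × PP) ↦ z.2.1 := continuous_fst.comp continuous_snd
  have hq : Continuous fun z : Blocks × Blocks × (PP × PP) ↦ z.2.2 := continuous_snd.comp continuous_snd
  have hW := continuous_fst.comp (continuous_snd.comp hq)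
  have hZ := continuous_snd.comp (continuous_snd.comp hq)
  have hU := continuous_fst.comp hq
  refine (continuous_const.mul (((hX.comp ((continuous_fst.comp hp').prodMk hW)).mul
    (hX.comp ((continuous_snd.comp (continuous_snd.comp hp)).prodMk hZ))).add
    ((hX.comp ((continuous_fst.comp hp).prodMk hW)).mul
    (hX.comp ((continuous_snd.comp (continuous_snd.comp hp')).prodMk hZ))))).sub
    ((continuous_const.mul (hY.comp ((continuous_fst.comp (continuous_snd.comp hp)).prodMk hU))).mul
    (hY.comp ((continuous_fst.comp (continuous_snd.comp hp')).prodMk hU)))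

/-- `(p, q) ↦ G` is continuous. [folklore] -/
theorem continuous_twoSingularG (Λ : ℝ) :
    Continuous fun z : Blocks × (PP × PP) ↦ twoSingularG Λ z.1 z.2 := by
  unfold twoSingularG
  have hX := continuous_pairSumQ'
  have hY := continuous_kyFanQ'
  have hp : Continuous fun z : Blocks × (PP × PP) ↦ z.1 := continuous_fst
  have hq : Continuous fun z : Blocks × (PP × PP) ↦ z.2 := continuous_snd
  have hW := continuous_fst.comp (continuous_snd.comp hq)
  have hZ := continuous_snd.comp (continuous_snd.comp hq)
  have hU := continuous_fst.comp hq
  exact ((continuous_const.mul (hX.comp ((continuous_fst.comp hp).prodMk hW))).mul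
    (hX.comp ((continuous_snd.comp (continuous_snd.comp hp)).prodMk hZ))).sub
    ((hY.comp ((continuous_fst.comp (continuous_snd.comp hp)).prodMk hU)).pow 2)

attribute [local irreducible] twoSingularG in
/-- Joint continuity of `G` along a continuous curve. [folklore] -/
theorem continuousOn_twoSingularG_family (Λ : ℝ) {γ : ℝ → Blocks} {S : Set ℝ} (hγ : ContinuousOn γ S)
    (K : Set (PP × PP)) : ContinuousOn (fun z : ℝ × (PP × PP) ↦ twoSingularG Λ (γ z.1) z.2) (S ×ˢ K) := by
  have h1 : ContinuousOn (fun z : ℝ × (PP × PP) ↦ γ z.1) (S ×ˢ K) :=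
    hγ.comp continuousOn_fst fun z hz ↦ (Set.mem_prod.1 hz).1
  exact (continuous_twoSingularG Λ).continuousOn.comp (h1.prodMk continuousOn_snd) (Set.mapsTo_univ _ _)

attribute [local irreducible] twoSingularG' in
/-- Joint continuity of `G'` along a continuous solution. [folklore] -/
theorem continuousOn_twoSingularG'_family (Λ : ℝ) {γ : ℝ → Blocks} {S : Set ℝ} (hγ : ContinuousOn γ S)
    (K : Set (PP × PP)) :
    ContinuousOn (fun z : ℝ × (PP × PP) ↦ twoSingularG' Λ (γ z.1) (field (γ z.1)) z.2) (S ×ˢ K) := by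
  have h1 : ContinuousOn (fun z : ℝ × (PP × PP) ↦ γ z.1) (S ×ˢ K) :=
    hγ.comp continuousOn_fst fun z hz ↦ (Set.mem_prod.1 hz).1
  exact (continuous_twoSingularG' Λ).continuousOn.comp
    (h1.prodMk ((continuous_field.comp_continuousOn h1).prodMk continuousOn_snd)) (Set.mapsTo_univ _ _)

/-! ### Normalising the maximising frames -/

/-- Flipping the `u`-frame changes the sign of every Ky Fan sum. [folklore] -/
theorem kyFanQ_flip (X : Matrix (Fin 3) (Fin 3) ℝ) (F : PP) :
    kyFanQ X ((-F.1.1, -F.1.2), F.2) = -kyFanQ X F := by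
  simp only [kyFanQ, neg_dotProduct]; ring

/-- The flipped frames are orthonormal pairs. [folklore] -/
theorem flip_mem {F : PP} (hF : F ∈ (pairSet ×ˢ pairSet : Set PP)) :
    ((-F.1.1, -F.1.2), F.2) ∈ (pairSet ×ˢ pairSet : Set PP) := by
  obtain ⟨⟨h1, h2, h12⟩, hV⟩ := hF
  exact ⟨⟨by simpa using h1, by simpa using h2, by simpa using h12⟩, hV⟩

/-- Simultaneous rotation of both frames. [folklore] -/
def rotatePP (c s : ℝ) (F : PP) : PP :=
  ((c • F.1.1 + s • F.1.2, -s • F.1.1 + c • F.1.2), (c • F.2.1 + s • F.2.2, -s • F.2.1 + c • F.2.2))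

/-- Rotation preserves every Ky Fan sum. [folklore] -/
theorem kyFanQ_rotate (X : Matrix (Fin 3) (Fin 3) ℝ) (F : PP) {c s : ℝ} (hcs : c ^ 2 + s ^ 2 = 1) :
    kyFanQ X (rotatePP c s F) = kyFanQ X F := by
  simp only [kyFanQ, rotatePP]
  exact kyFan_rotate X F.1.1 F.1.2 F.2.1 F.2.2 hcs

/-- Rotated frames are orthonormal pairs. [folklore] -/
theorem rotate_mem {F : PP} (hF : F ∈ (pairSet ×ˢ pairSet : Set PP)) {c s : ℝ} (hcs : c ^ 2 + s ^ 2 = 1) :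
    rotatePP c s F ∈ (pairSet ×ˢ pairSet : Set PP) := by
  obtain ⟨⟨h1, h2, h12⟩, ⟨k1, k2, k12⟩⟩ := hF
  obtain ⟨a1, a2, a12⟩ := rotate_orthonormal h1 h2 h12 hcs (σ := 1) (by norm_num)
  obtain ⟨b1, b2, b12⟩ := rotate_orthonormal k1 k2 k12 hcs (σ := 1) (by norm_num)
  simp only [one_mul] at a2 a12 b2 b12
  exact ⟨⟨a1, a2, a12⟩, ⟨b1, b2, b12⟩⟩

/-- **A maximiser can be rotated to a diagonal maximiser** with the same Ky Fan sums for every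
matrix. [folklore] -/
theorem exists_diag_maximiser {B : Matrix (Fin 3) (Fin 3) ℝ} {F : PP} (hF : F ∈ (pairSet ×ˢ pairSet : Set PP))
    (hmax : ∀ F' ∈ (pairSet ×ˢ pairSet : Set PP), kyFanQ B F' ≤ kyFanQ B F) :
    ∃ F₀ ∈ (pairSet ×ˢ pairSet : Set PP), (∀ X : Matrix (Fin 3) (Fin 3) ℝ, kyFanQ X F₀ = kyFanQ X F) ∧
      F₀.1.1 ⬝ᵥ (B *ᵥ F₀.2.2) = 0 := by
  obtain ⟨⟨u₁, u₂⟩, ⟨v₁, v₂⟩⟩ := F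
  obtain ⟨⟨hu₁, hu₂, hu⟩, ⟨hv₁, hv₂, hv⟩⟩ := hF
  have hmax' : ∀ u₁' u₂' v₁' v₂' : Fin 3 → ℝ, u₁' ⬝ᵥ u₁' = 1 → u₂' ⬝ᵥ u₂' = 1 → u₁' ⬝ᵥ u₂' = 0 →
      v₁' ⬝ᵥ v₁' = 1 → v₂' ⬝ᵥ v₂' = 1 → v₁' ⬝ᵥ v₂' = 0 →
      u₁' ⬝ᵥ (B *ᵥ v₁') + u₂' ⬝ᵥ (B *ᵥ v₂') ≤ u₁ ⬝ᵥ (B *ᵥ v₁) + u₂ ⬝ᵥ (B *ᵥ v₂) :=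
    fun u₁' u₂' v₁' v₂' a b c d e f ↦ hmax ((u₁', u₂'), (v₁', v₂')) ⟨⟨a, b, c⟩, ⟨d, e, f⟩⟩
  have hsymm := kyFanMax_symm hu₁ hu₂ hu hv₁ hv₂ hv hmax'
  obtain ⟨c, s, hcs, hang⟩ := exists_halfAngle (u₁ ⬝ᵥ (B *ᵥ v₁) - u₂ ⬝ᵥ (B *ᵥ v₂)) (u₁ ⬝ᵥ (B *ᵥ v₂))
  refine ⟨rotatePP c s ((u₁, u₂), (v₁, v₂)), rotate_mem ⟨⟨hu₁, hu₂, hu⟩, ⟨hv₁, hv₂, hv⟩⟩ hcs,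
    fun X ↦ kyFanQ_rotate X _ hcs, ?_⟩
  simp only [rotatePP, Matrix.mulVec_add, Matrix.mulVec_smul, Matrix.mulVec_neg, dotProduct_add,
    add_dotProduct, dotProduct_smul, smul_dotProduct, neg_smul, dotProduct_neg, smul_eq_mul,
    hsymm]
  linear_combination hang

/-- `|uᵀXv| ≤ Σ|X_{kl}|` for unit `u, v`. [folklore] -/
theorem abs_bilin_le_sum (X : Matrix (Fin 3) (Fin 3) ℝ) {u v : Fin 3 → ℝ} (hu : u ⬝ᵥ u = 1)
    (hv : v ⬝ᵥ v = 1) : |u ⬝ᵥ (X *ᵥ v)| ≤ ∑ k, ∑ l, |X k l| := by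
  simp only [dotProduct, Matrix.mulVec, Finset.mul_sum]
  refine (Finset.abs_sum_le_sum_abs _ _).trans (Finset.sum_le_sum fun k _ ↦
    (Finset.abs_sum_le_sum_abs _ _).trans (Finset.sum_le_sum fun l _ ↦ ?_))
  rw [abs_mul, abs_mul]
  have hk := abs_apply_le_one_of_dot_self hu k
  have hl := abs_apply_le_one_of_dot_self hv l
  have := abs_nonneg (X k l)
  calc |u k| * (|X k l| * |v l|) ≤ 1 * (|X k l| * 1) := by gcongr
    _ = |X k l| := by ring

/-! ### The sign condition at a minimiser -/

/-- **The sign condition at a minimiser of `G`** (pointwise, Hamilton 1997, Thm. 1.3): with the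
constraint data at one time and `R ≥ Σ|A| + Σ|B| + Σ|C|`, if `G ≤ 0` at a minimiser then
`8R · G ≤ G'`. [cite: Hamilton1997, §2.1, Thm. 1.3 (proof, p. 8)] -/
theorem twoSingular_sign {Λ m R : ℝ} (hΛ : 0 < Λ) (hm : 0 < m) {p : Blocks} (hA : p.1.IsSymm)
    (hC : p.2.2.IsSymm) (h12A : p.1.TwoSmallestEigenvaluesSumGE m) (h12C : p.2.2.TwoSmallestEigenvaluesSumGE m)
    (hR : (∑ k, ∑ l, |p.1 k l|) + (∑ k, ∑ l, |p.2.1 k l|) + ∑ k, ∑ l, |p.2.2 k l| ≤ R)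
    {q : PP × PP} (hq : q ∈ pairSet4) (hqmin : IsMinOn (twoSingularG Λ p) pairSet4 q)
    (hG0 : twoSingularG Λ p q ≤ 0) :
    8 * R * twoSingularG Λ p q ≤ twoSingularG' Λ p (field p) q := by
  obtain ⟨F, ⟨w, w'⟩, ⟨z, z'⟩⟩ := q
  obtain ⟨hF, ⟨hw, hw', hww'⟩, ⟨hz, hz', hzz'⟩⟩ := hq
  obtain ⟨A, B, C⟩ := p
  simp only at hA hC h12A h12C hR hqmin hG0 ⊢
  -- positivity of the pair sums
  have hX : m ≤ pairSumQ A (w, w') := h12A w w' hw hw' hww'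
  have hXC : m ≤ pairSumQ C (z, z') := h12C z z' hz hz' hzz'
  have hXpos : 0 < pairSumQ A (w, w') := by linarith
  have hXCpos : 0 < pairSumQ C (z, z') := by linarith
  -- decoupling
  have hminW : ∀ r ∈ pairSet, pairSumQ A (w, w') ≤ pairSumQ A r := by
    intro r hr
    have h := hqmin (show (F, (r, (z, z'))) ∈ pairSet4 from ⟨hF, hr, ⟨hz, hz', hzz'⟩⟩)
    simp only [mem_setOf_eq, twoSingularG] at h
    nlinarith [mul_pos hΛ hXCpos]
  have hminZ : ∀ r ∈ pairSet, pairSumQ C (z, z') ≤ pairSumQ C r := by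
    intro r hr
    have h := hqmin (show (F, ((w, w'), r)) ∈ pairSet4 from ⟨hF, ⟨hw, hw', hww'⟩, hr⟩)
    simp only [mem_setOf_eq, twoSingularG] at h
    nlinarith [mul_pos hΛ hXpos]
  have hmaxF : ∀ F' ∈ (pairSet ×ˢ pairSet : Set PP), kyFanQ B F' ^ 2 ≤ kyFanQ B F ^ 2 := by
    intro F' hF'
    have h := hqmin (show (F', ((w, w'), (z, z'))) ∈ pairSet4 from ⟨hF', ⟨hw, hw', hww'⟩, ⟨hz, hz', hzz'⟩⟩)
    simp only [mem_setOf_eq, twoSingularG] at h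
    linarith
  -- flip to a non-negative maximiser, then rotate to a diagonal one
  obtain ⟨Fb, hFb, hYnn, hflip⟩ : ∃ Fb ∈ (pairSet ×ˢ pairSet : Set PP), 0 ≤ kyFanQ B Fb ∧
      ∃ σ : ℝ, σ ^ 2 = 1 ∧ ∀ X : Matrix (Fin 3) (Fin 3) ℝ, kyFanQ X Fb = σ * kyFanQ X F := by
    rcases le_or_gt 0 (kyFanQ B F) with h | h
    · exact ⟨F, hF, h, 1, by norm_num, fun X ↦ by ring⟩
    · exact ⟨_, flip_mem hF, by rw [kyFanQ_flip]; linarith, -1, by norm_num, fun X ↦ by rw [kyFanQ_flip]; ring⟩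
  obtain ⟨σ, hσ, hσX⟩ := hflip
  have hmaxb : ∀ F' ∈ (pairSet ×ˢ pairSet : Set PP), kyFanQ B F' ≤ kyFanQ B Fb := by
    intro F' hF'
    have h1 := hmaxF F' hF'
    have h2 : kyFanQ B Fb ^ 2 = kyFanQ B F ^ 2 := by rw [hσX B, mul_pow, hσ, one_mul]
    rw [← h2] at h1
    nlinarith [abs_le_abs (le_abs_self (kyFanQ B F')) (neg_le_abs _), sq_abs (kyFanQ B F'),
      abs_nonneg (kyFanQ B F')]
  obtain ⟨F₀, hF₀, hF₀X, hdiag⟩ := exists_diag_maximiser hFb hmaxb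
  obtain ⟨⟨u₁, u₂⟩, ⟨v₁, v₂⟩⟩ := F₀
  obtain ⟨⟨hu₁, hu₂, hu⟩, ⟨hv₁, hv₂, hv⟩⟩ := hF₀
  simp only at hdiag hF₀X
  have hmax₀ : ∀ u₁' u₂' v₁' v₂' : Fin 3 → ℝ, u₁' ⬝ᵥ u₁' = 1 → u₂' ⬝ᵥ u₂' = 1 → u₁' ⬝ᵥ u₂' = 0 →
      v₁' ⬝ᵥ v₁' = 1 → v₂' ⬝ᵥ v₂' = 1 → v₁' ⬝ᵥ v₂' = 0 →
      u₁' ⬝ᵥ (B *ᵥ v₁') + u₂' ⬝ᵥ (B *ᵥ v₂') ≤ u₁ ⬝ᵥ (B *ᵥ v₁) + u₂ ⬝ᵥ (B *ᵥ v₂) := by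
    intro u₁' u₂' v₁' v₂' a b c d e f
    have h := hmaxb ((u₁', u₂'), (v₁', v₂')) ⟨⟨a, b, c⟩, ⟨d, e, f⟩⟩
    rw [← hF₀X B] at h
    exact h
  -- the values `Y₀ = |Y| ≥ 0` and `Y₀ Y₀' = Y Y'`
  have hY0 : 0 ≤ u₁ ⬝ᵥ (B *ᵥ v₁) + u₂ ⬝ᵥ (B *ᵥ v₂) := by
    have h1 : u₁ ⬝ᵥ (B *ᵥ v₁) + u₂ ⬝ᵥ (B *ᵥ v₂) = kyFanQ B Fb := hF₀X B
    rw [h1]; exact hYnn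
  have hYY : ∀ X : Matrix (Fin 3) (Fin 3) ℝ,
      (u₁ ⬝ᵥ (B *ᵥ v₁) + u₂ ⬝ᵥ (B *ᵥ v₂)) * (u₁ ⬝ᵥ (X *ᵥ v₁) + u₂ ⬝ᵥ (X *ᵥ v₂)) =
        kyFanQ B F * kyFanQ X F := by
    intro X
    have h1 : u₁ ⬝ᵥ (B *ᵥ v₁) + u₂ ⬝ᵥ (B *ᵥ v₂) = σ * kyFanQ B F := (hF₀X B).trans (hσX B)
    have h2 : u₁ ⬝ᵥ (X *ᵥ v₁) + u₂ ⬝ᵥ (X *ᵥ v₂) = σ * kyFanQ X F := (hF₀X X).trans (hσX X)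
    rw [h1, h2]
    linear_combination (kyFanQ B F * kyFanQ X F) * hσ
  have hY2 : (u₁ ⬝ᵥ (B *ᵥ v₁) + u₂ ⬝ᵥ (B *ᵥ v₂)) ^ 2 = kyFanQ B F ^ 2 := by rw [sq, hYY B, sq]
  -- normals of the minimising pairs
  have hnA1 : (w ⨯₃ w') ⬝ᵥ (w ⨯₃ w') = 1 := dotProduct_cross_self_of_orthonormal hw hw' hww'
  have hwn : w ⬝ᵥ (w ⨯₃ w') = 0 := dot_self_cross w w'
  have hw'n : w' ⬝ᵥ (w ⨯₃ w') = 0 := dot_cross_self w w'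
  have hnC1 : (z ⨯₃ z') ⬝ᵥ (z ⨯₃ z') = 1 := dotProduct_cross_self_of_orthonormal hz hz' hzz'
  have hzn : z ⬝ᵥ (z ⨯₃ z') = 0 := dot_self_cross z z'
  have hz'n : z' ⬝ᵥ (z ⨯₃ z') = 0 := dot_cross_self z z'
  have hminW' : ∀ y y' : Fin 3 → ℝ, y ⬝ᵥ y = 1 → y' ⬝ᵥ y' = 1 → y ⬝ᵥ y' = 0 →
      w ⬝ᵥ (A *ᵥ w) + w' ⬝ᵥ (A *ᵥ w') ≤ y ⬝ᵥ (A *ᵥ y) + y' ⬝ᵥ (A *ᵥ y') :=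
    fun y y' a b c ↦ hminW (y, y') ⟨a, b, c⟩
  have hminZ' : ∀ y y' : Fin 3 → ℝ, y ⬝ᵥ y = 1 → y' ⬝ᵥ y' = 1 → y ⬝ᵥ y' = 0 →
      z ⬝ᵥ (C *ᵥ z) + z' ⬝ᵥ (C *ᵥ z') ≤ y ⬝ᵥ (C *ᵥ y) + y' ⬝ᵥ (C *ᵥ y') :=
    fun y y' a b c ↦ hminZ (y, y') ⟨a, b, c⟩
  have hMA : ∀ e : Fin 3 → ℝ, e ⬝ᵥ e = 1 → e ⬝ᵥ (A *ᵥ e) ≤ (w ⨯₃ w') ⬝ᵥ (A *ᵥ (w ⨯₃ w')) :=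
    fun e he ↦ rayleigh_le_normal_of_min hw hw' hnA1 hww' hwn hw'n hminW' he
  have hMC : ∀ e : Fin 3 → ℝ, e ⬝ᵥ e = 1 → e ⬝ᵥ (C *ᵥ e) ≤ (z ⨯₃ z') ⬝ᵥ (C *ᵥ (z ⨯₃ z')) :=
    fun e he ↦ rayleigh_le_normal_of_min hz hz' hnC1 hzz' hzn hz'n hminZ' he
  obtain ⟨hXw, hXw'⟩ := critical_of_isMinOn hA hw hw' hww' hminW
  obtain ⟨hXz, hXz'⟩ := critical_of_isMinOn hC hz hz' hzz' hminZ
  -- `κ` and the three bounds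
  set κ := (u₁ ⨯₃ u₂) ⬝ᵥ (B *ᵥ (v₁ ⨯₃ v₂)) with hκ
  have hup := kyFanMax_upper (A := A) (C := C) hu₁ hu₂ hu hv₁ hv₂ hv hmax₀ hdiag hMA hMC
  have hkw := normSq_transpose_ge_kappa_sq hu₁ hu₂ hu hv₁ hv₂ hv hmax₀ hdiag w hw
  have hkw' := normSq_transpose_ge_kappa_sq hu₁ hu₂ hu hv₁ hv₂ hv hmax₀ hdiag w' hw'
  have hkz := normSq_ge_kappa_sq hu₁ hu₂ hu hv₁ hv₂ hv hmax₀ hdiag z hz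
  have hkz' := normSq_ge_kappa_sq hu₁ hu₂ hu hv₁ hv₂ hv hmax₀ hdiag z' hz'
  have hlowA := pairMin_lower (B := B) hA hw hw' hnA1 hww' hwn hw'n hXw hXw' hkw hkw'
  have hlowC := pairMin_lower (A := C) (B := Bᵀ) hC hz hz' hnC1 hzz' hzn hz'n hXz hXz'
    (by rw [Matrix.transpose_transpose]; exact hkz) (by rw [Matrix.transpose_transpose]; exact hkz')
  rw [Matrix.transpose_transpose] at hlowC
  -- bookkeeping
  have key := twoSingular_scalar (Λ := Λ) (X := pairSumQ A (w, w')) (XC := pairSumQ C (z, z')) hΛ.le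
    hXpos.le hXCpos.le hY0 hup (by simpa only [pairSumQ] using hlowA) (by simpa only [pairSumQ] using hlowC)
  -- compare constants
  have hAnn : 0 ≤ ∑ k, ∑ l, |A k l| := Finset.sum_nonneg fun k _ ↦ Finset.sum_nonneg fun l _ ↦ abs_nonneg (A k l)
  have hBnn : 0 ≤ ∑ k, ∑ l, |B k l| := Finset.sum_nonneg fun k _ ↦ Finset.sum_nonneg fun l _ ↦ abs_nonneg (B k l)
  have hCnn : 0 ≤ ∑ k, ∑ l, |C k l| := Finset.sum_nonneg fun k _ ↦ Finset.sum_nonneg fun l _ ↦ abs_nonneg (C k l)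
  have hκR : |κ| ≤ R := by
    have h1 := abs_bilin_le_sum B (dotProduct_cross_self_of_orthonormal hu₁ hu₂ hu)
      (dotProduct_cross_self_of_orthonormal hv₁ hv₂ hv)
    linarith
  have hMAR : (w ⨯₃ w') ⬝ᵥ (A *ᵥ (w ⨯₃ w')) ≤ R := by
    have h1 := (abs_le.1 (abs_quad_le_sum A hnA1)).2
    linarith
  have hMCR : (z ⨯₃ z') ⬝ᵥ (C *ᵥ (z ⨯₃ z')) ≤ R := by
    have h1 := (abs_le.1 (abs_quad_le_sum C hnC1)).2
    linarith
  have hS : 2 * ((w ⨯₃ w') ⬝ᵥ (A *ᵥ (w ⨯₃ w')) + (z ⨯₃ z') ⬝ᵥ (C *ᵥ (z ⨯₃ z')) + 2 * |κ|) ≤ 8 * R := by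
    linarith
  have hGval : twoSingularG Λ (A, B, C) (F, (w, w'), (z, z')) =
      Λ * pairSumQ A (w, w') * pairSumQ C (z, z') - (u₁ ⬝ᵥ (B *ᵥ v₁) + u₂ ⬝ᵥ (B *ᵥ v₂)) ^ 2 := by
    rw [hY2]; simp only [twoSingularG]
  have hG'val : twoSingularG' Λ (A, B, C) (field (A, B, C)) (F, (w, w'), (z, z')) =
      Λ * (pairSumQ (A * A + B * Bᵀ + (2 : ℝ) • A.sharp) (w, w') * pairSumQ C (z, z') +
        pairSumQ A (w, w') * pairSumQ (C * C + Bᵀ * B + (2 : ℝ) • C.sharp) (z, z')) -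
        2 * (kyFanQ B F * kyFanQ (A * B + B * C + (2 : ℝ) • B.sharp) F) := by
    simp only [twoSingularG', field]
    ring
  rw [← hYY] at hG'val
  have hGle : twoSingularG Λ (A, B, C) (F, (w, w'), (z, z')) ≤ 0 := hG0
  have hfin : 8 * R * twoSingularG Λ (A, B, C) (F, (w, w'), (z, z')) ≤
      2 * ((w ⨯₃ w') ⬝ᵥ (A *ᵥ (w ⨯₃ w')) + (z ⨯₃ z') ⬝ᵥ (C *ᵥ (z ⨯₃ z')) + 2 * |κ|) *
        twoSingularG Λ (A, B, C) (F, (w, w'), (z, z')) := mul_le_mul_of_nonpos_right hS hGle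
  refine hfin.trans ?_
  rw [hGval, hG'val]
  simp only [pairSumQ] at key ⊢
  linarith [key]

/-- **Hamilton 1997, Thm. 1.3, ODE part (proved)** — exactly the Thm. 1.3 hypothesis of
`hamilton_chenZhu_pinching_of_ode₅` (`PinchingEstimatesReduction3.lean`): for `0 < m`, `0 < Λ`,
`{(b₂ + b₃)² ≤ Λ(a₁ + a₂)(c₁ + c₂)}` is forward invariant under Hamilton's ODE relative to
`{A, C symmetric} ∩ {a₁ + a₂ ≥ m} ∩ {c₁ + c₂ ≥ m}`. [cite: Hamilton1997, §2.1, Thm. 1.3 (pp. 7–8)] -/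
theorem hamilton1997_B13_ode : ∀ m Λ : ℝ, 0 < m → 0 < Λ →
    IsInvariantRel field
      (fun _ ↦ {p : Blocks | (p.1.IsSymm ∧ p.2.2.IsSymm) ∧ p.1.TwoSmallestEigenvaluesSumGE m ∧
        p.2.2.TwoSmallestEigenvaluesSumGE m})
      (fun _ ↦ {p | SingularValuesSumSqLE p Λ}) := by
  intro m Λ hm hΛ γ t₀ t₁ _ h₁ hγ hK hin
  have hγc := IsSolutionOn.continuousOn hγ
  have hGc := continuousOn_twoSingularG_family Λ hγc pairSet4
  have hG'c := continuousOn_twoSingularG'_family Λ hγc pairSet4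
  have hGd : ∀ q ∈ pairSet4, ∀ s ∈ Icc t₀ t₁, _root_.HasDerivAt (fun t ↦ twoSingularG Λ (γ t) q)
      (twoSingularG' Λ (γ s) (field (γ s)) q) s := fun q _ s hs ↦ hasDerivAt_twoSingularG Λ (hγ s hs) q
  -- uniform bound `R` for `Σ|A| + Σ|B| + Σ|C|`
  have hent : ∀ {f : Blocks → Matrix (Fin 3) (Fin 3) ℝ}, Continuous f →
      ContinuousOn (fun t ↦ ∑ k, ∑ l, |f (γ t) k l|) (Icc t₀ t₁) := by
    intro f hf
    have h : ContinuousOn (fun t ↦ f (γ t)) (Icc t₀ t₁) := hf.comp_continuousOn hγc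
    exact continuousOn_finsetSum _ fun k _ ↦ continuousOn_finsetSum _ fun l _ ↦
      ((continuousOn_pi.1 (continuousOn_pi.1 h k) l)).abs
  have hScont : ContinuousOn (fun t ↦ (∑ k, ∑ l, |(γ t).1 k l|) + (∑ k, ∑ l, |(γ t).2.1 k l|) +
      ∑ k, ∑ l, |(γ t).2.2 k l|) (Icc t₀ t₁) :=
    ((hent (f := fun p ↦ p.1) continuous_fst).add
      (hent (f := fun p ↦ p.2.1) (continuous_fst.comp continuous_snd))).add
      (hent (f := fun p ↦ p.2.2) (continuous_snd.comp continuous_snd))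
  obtain ⟨sR, -, hR⟩ := isCompact_Icc.exists_isMaxOn (nonempty_Icc.2 h₁) hScont
  set R := (∑ k, ∑ l, |(γ sR).1 k l|) + (∑ k, ∑ l, |(γ sR).2.1 k l|) + ∑ k, ∑ l, |(γ sR).2.2 k l|
    with hRdef
  have hR' : ∀ s ∈ Icc t₀ t₁, (∑ k, ∑ l, |(γ s).1 k l|) + (∑ k, ∑ l, |(γ s).2.1 k l|) +
      ∑ k, ∑ l, |(γ s).2.2 k l| ≤ R := fun s hs ↦ hR hs
  have hC0 : 0 ≤ 8 * R := by positivity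
  have key := minOverSet_nonneg_of_deriv (G := fun t q ↦ twoSingularG Λ (γ t) q)
    (G' := fun t q ↦ twoSingularG' Λ (γ t) (field (γ t)) q) isCompact_pairSet4 pairSet4_nonempty
    hGc hGd hG'c h₁ one_pos hC0 (η := 1) (fun s hs q hq hqmin _ hG0 ↦ ?_) ?_
  · rw [mem_setOf_eq, singularValuesSumSqLE_iff]
    exact (le_minOverSet_iff isCompact_pairSet4 pairSet4_nonempty (continuousOn_slice
      (G := fun t q ↦ twoSingularG Λ (γ t) q) hGc (right_mem_Icc.2 h₁)) 0).1 key
  · have hsI : s ∈ Icc t₀ t₁ := Ico_subset_Icc_self hs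
    obtain ⟨⟨hA, hC⟩, h12A, h12C⟩ := hK s hsI
    exact twoSingular_sign hΛ hm hA hC h12A h12C (hR' s hsI) hq hqmin hG0
  · refine (le_minOverSet_iff isCompact_pairSet4 pairSet4_nonempty (continuousOn_slice
      (G := fun t q ↦ twoSingularG Λ (γ t) q) hGc (left_mem_Icc.2 h₁)) 0).2 ?_
    exact (singularValuesSumSqLE_iff Λ (γ t₀)).1 hin

end HamiltonODE

end Literature.Geometry.Riemannian

end
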